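import Literature.NumberTheory.Automorphic.UnitaryCurveCohCotangentFormsContinuous
import Literature.NumberTheory.Automorphic.DiscreteAutomorphicRepNormalFixedVectors
import Summits.HodgeConjecture.HodgeConjecture.Theorems.H413SpectrumJunction
import HarnessLib

/-!
# Crux `HLiu418`, line LD2 (organs B₂ ∕ C₂away) — the rank-2 HOLOMORPHIC-COTANGENT TEST VECTOR: a non-zero `L²`-class of a holomorphic cotangent
# form in `P`, and the vector-by-vector invariance of `P` under the compact archimedean factor `K_c(w₁)`

Cell hodgecm-mathlib (D-0151), FLOOR 0; crux item `HLiu418` = stmt-HodgeConjecture-24832; half-A line LD2 (socket `stub_S1b_facts`), organs B₂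
`ThetaFinComponent₂` and C₂away `ArchTypeAway₂` of the LD2 skeleton (planner LD2-plan (g0), v1 :206 ∕ :348).  Seat LD2-p02 (g0).  THEOREMS ONLY
(no `def`, no instance, no notation, no named fact, no `sorry`); `--supports stmt-HodgeConjecture-24832 --as helper`.  HC_CM is proved only modulo the 7
printed citations (2 remaining: hLiu418, h413) until rung 0 closes; this file discharges nothing printed.

Both organs consume ★ `IsHolCotangentAt₂` only as a TEST VECTOR («`P` contains a non-zero holomorphic cotangent form», [Liu2021, App. D l. 5357–5359];
[BorelWallach2000, VII 3.2]).  At `n = 3` the two uses are ★ `F0P2aCohFormsContinuous.exists_toLp_ne_zero_of_mem_cohForms_cm` (a non-zero function has a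
non-zero CLASS: continuity + positivity of `μ` on opens) and ★ `ThetaLiftFromLineCompactInvariance.rightRegular_eq_self_of_mem_cmCompactFactor` (a
holomorphic-cotangent `P` is fixed by the compact factor vector by vector).  This file is their rank-2 twin over the cone carriers ★
`UnitaryCurveForms.holCotForms₂` (generic datum `(F, E, c, J)`, one complex place `w₁`, compact factor `K_c(w₁) := (ker archAt w₁).map archToAdelic`):

* §1 `left_inv_of_mem_holCotForms₂` (clause (L) read on `A_G · U(J)(F)`), `memLp_toQuotFun_of_mem_holCotForms₂` (compact quotient, finite measure),
  `toLp_toQuotFun_ne_zero_of_mem_holCotForms₂` (★ `SpectrumJunction.toLp_toQuotFun_ne_zero` + ★ `continuous_of_mem_holCotForms₂`, `μ` positive on opens),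
  **`exists_toLp_ne_zero_of_isHolCotangentAt₂`** — `IsHolCotangentAt₂ P … 𝔣 ⇒ ∃ f ∈ holCotForms₂ … 𝔣, ∃ h, [f] ∈ P ∧ [f] ≠ 0`;
* §2 `normal_kerArchAt₂` (★ `normal_map_archToAdelic`), **`rightRegular_eq_self_of_mem_kerArchAt₂`** — `R(k) v = v` for `k ∈ K_c(w₁)`, `v ∈ P` (★
  `DiscreteAutomorphicRep.rightRegular_eq_self_of_form` with clause (Kc)), `rightRegular_starProjection_of_mem_kerArchAt₂` — `R(k) (pr_P x) = pr_P x`.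

## References
* [BorelJacquet1979] A. Borel, H. Jacquet, PSPM 33.1 (1979), §4.1, §4.6.  [BorelWallach2000] VII 3.2.
* [DeitmarEchterhoff2014] A. Deitmar, S. Echterhoff, *Principles of Harmonic Analysis*, 2nd ed., Thm. 7.3.2.
* [Liu2021] Y. Liu, Camb. J. Math. 9 (2021), App. D l. 5357–5359; proof of Prop. 4.13 Case 1 (l. 2137–2141).
-/

set_option autoImplicit false
-- the mandated namespace has the single-problem summit's repeated segment (`HodgeConjecture.HodgeConjecture`)
set_option linter.dupNamespace false

noncomputable section

open NumberField NumberField.InfinitePlace MeasureTheory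
open scoped ComplexOrder Matrix ENNReal

namespace Summit.HodgeConjecture.HodgeConjecture.Cruxes.HLiu418.F0LD2CurveHolTestVector

open Literature.NumberTheory.Automorphic Literature.NumberTheory.Automorphic.UnitaryGroup
open Literature.NumberTheory.Automorphic.UnitaryGroup.CotangentForms (toQuotFun toQuotFun_mk)
open Literature.NumberTheory.Automorphic.UnitaryCurveForms
open Summit.HodgeConjecture.HodgeConjecture.Cruxes.H413

variable {F E : Type} [Field F] [NumberField F] [Field E] [NumberField E] [Algebra F E] {c : E ≃ₐ[F] E}
  {J : Matrix (Fin 2) (Fin 2) E} {hc : c ≠ 1} {hfix : ∀ w : InfinitePlace E, c • w = w} {w₁ : {w : InfinitePlace E // IsComplex w}}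
  {𝔣 : ConeFrame E J w₁}

/-! ## §1 A non-zero holomorphic cotangent form in `P` has a non-zero `L²`-class -/

/-- A holomorphic cotangent form is left-invariant under `A_G · U(J)(F)` (`A_G = 1` for the unitary datum; clause (L) of ★ `mem_holCotForms₂_iff`).
[cite: BorelJacquet1979, §4.2] -/
theorem left_inv_of_mem_holCotForms₂ {f : (adelicGroupData F E c 2 J).Adelic → ℂ} (hf : f ∈ holCotForms₂ F E c J hc hfix w₁ 𝔣) :
    ∀ γ ∈ (adelicGroupData F E c 2 J).quotientSubgroup, ∀ g, f (γ * g) = f g := by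
  intro γ hγ g
  obtain ⟨hL, -, -, -⟩ := (mem_holCotForms₂_iff F E c J hc hfix w₁ 𝔣 f).1 hf
  have hγ' : γ ∈ (⊥ : Subgroup _) ⊔ (toAdelic F E c 2 J).range := hγ
  rw [bot_sup_eq] at hγ'
  obtain ⟨γr, rfl⟩ := hγ'
  exact hL γr g

/-- The right `K_c(w₁)`-invariance of a holomorphic cotangent form (clause (Kc) of ★ `mem_holCotForms₂_iff`). [cite: BorelJacquet1979, §4.1] -/
theorem right_inv_of_mem_holCotForms₂ {f : (adelicGroupData F E c 2 J).Adelic → ℂ} (hf : f ∈ holCotForms₂ F E c J hc hfix w₁ 𝔣) :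
    ∀ k ∈ ((archAt F E c 2 J w₁ (hfix w₁.1) hc).ker).map (archToAdelic F E c 2 J), ∀ x, f (x * k) = f x :=
  ((mem_holCotForms₂_iff F E c J hc hfix w₁ 𝔣 f).1 hf).2.1

variable {μ : Measure (adelicGroupData F E c 2 J).automorphicQuotient}

/-- **`L^p` of the descent on a compact quotient**: for a finite measure on a COMPACT automorphic quotient `[U(J)]` (e.g. `J` anisotropic), the descent
of every `f ∈ holCotForms₂ … 𝔣` is in `L^p` (★ `SpectrumJunction.memLp_toQuotFun`: left-invariance + ★ `continuous_of_mem_holCotForms₂`).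
[cite: BorelJacquet1979, §4.6] -/
theorem memLp_toQuotFun_of_mem_holCotForms₂ [CompactSpace (adelicGroupData F E c 2 J).automorphicQuotient] [IsFiniteMeasure μ]
    {f : (adelicGroupData F E c 2 J).Adelic → ℂ} (hf : f ∈ holCotForms₂ F E c J hc hfix w₁ 𝔣) (p : ℝ≥0∞) :
    MemLp (toQuotFun (adelicGroupData F E c 2 J) f) p μ :=
  SpectrumJunction.memLp_toQuotFun (left_inv_of_mem_holCotForms₂ hf) (continuous_of_mem_holCotForms₂ F E c J hc hfix w₁ 𝔣 hf) p

/-- **A non-zero holomorphic cotangent form has a non-zero `L^p`-class** when `μ` is positive on open sets (e.g. automorphic): ★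
`SpectrumJunction.toLp_toQuotFun_ne_zero` with left-invariance and continuity (★ `continuous_of_mem_holCotForms₂`) discharged. [cite: BorelJacquet1979, §4.6] -/
theorem toLp_toQuotFun_ne_zero_of_mem_holCotForms₂ [μ.IsOpenPosMeasure]
    {f : (adelicGroupData F E c 2 J).Adelic → ℂ} (hf : f ∈ holCotForms₂ F E c J hc hfix w₁ 𝔣) (hne : f ≠ 0) {p : ℝ≥0∞}
    (hm : MemLp (toQuotFun (adelicGroupData F E c 2 J) f) p μ) :
    hm.toLp (toQuotFun (adelicGroupData F E c 2 J) f) ≠ 0 :=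
  SpectrumJunction.toLp_toQuotFun_ne_zero (left_inv_of_mem_holCotForms₂ hf) (continuous_of_mem_holCotForms₂ F E c J hc hfix w₁ 𝔣 hf) hm hne

/-- **THE RANK-2 HOLOMORPHIC-COTANGENT TEST VECTOR.**  If the discrete automorphic `P` is `H¹`-cohomological of Hodge type `(1,0)` at `w₁` (★
`IsHolCotangentAt₂ P … 𝔣`: `P` contains the class of a non-zero `f ∈ holCotForms₂ … 𝔣`), then for `μ` positive on open sets that class is a NON-ZERO vector
of `P`: `∃ f ∈ holCotForms₂ … 𝔣, ∃ h, [f] ∈ P ∧ [f] ≠ 0` — the shape in which node B (★ `exists_hasFinComponent_rhoAtLine_of_holCotForm`) and node Cc (★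
`rightRegular_eq_self_of_mem_cmCompactFactor`) consume the Hodge type at `n = 3`. [cite: Liu2021, App. D l. 5357–5359] [cite: BorelWallach2000, VII 3.2]
[cite: BorelJacquet1979, §4.6] -/
theorem exists_toLp_ne_zero_of_isHolCotangentAt₂ [μ.IsOpenPosMeasure]
    [SMulInvariantMeasure (adelicGroupData F E c 2 J).Adelic (adelicGroupData F E c 2 J).automorphicQuotient μ]
    (P : DiscreteAutomorphicRep (adelicGroupData F E c 2 J) μ) (hP : P.IsHolCotangentAt₂ hc hfix w₁ 𝔣) :
    ∃ f ∈ holCotForms₂ F E c J hc hfix w₁ 𝔣, ∃ h : MemLp (toQuotFun (adelicGroupData F E c 2 J) f) 2 μ,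
      h.toLp _ ∈ P.space.toSubmodule ∧ h.toLp _ ≠ 0 := by
  obtain ⟨f, hf, hne, h, hmem⟩ := hP
  exact ⟨f, hf, h, hmem, toLp_toQuotFun_ne_zero_of_mem_holCotForms₂ hf hne h⟩

/-! ## §2 A holomorphic-cotangent `P` is fixed by the compact factor `K_c(w₁)` vector by vector -/

/-- **`K_c(w₁) = (ker archAt w₁).map archToAdelic` is a NORMAL subgroup of `U(J)(𝔸_F)`** (★ `normal_map_archToAdelic` on the kernel of the projection to the
`w₁`-factor). [cite: BorelJacquet1979, §4.1] -/
theorem normal_kerArchAt₂ : (((archAt F E c 2 J w₁ (hfix w₁.1) hc).ker).map (archToAdelic F E c 2 J)).Normal :=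
  normal_map_archToAdelic F E c 2 J (MonoidHom.normal_ker _)

/-- **A holomorphic-cotangent `P` is `K_c(w₁)`-FIXED vector by vector**: if `P` contains the non-zero class of some `f ∈ holCotForms₂ … 𝔣` (right-`K_c(w₁)`-invariant
by clause (Kc), left-invariant by clause (L)), then `R(k) v = v` for every `k ∈ K_c(w₁)` and every `v ∈ P` (★ `DiscreteAutomorphicRep.rightRegular_eq_self_of_form`
with `normal_kerArchAt₂`) — «`P_w` is the trivial representation at every complex place `w ≠ w₁`». [cite: BorelJacquet1979, §4.6]
[cite: DeitmarEchterhoff2014, Thm. 7.3.2] [cite: Liu2021, proof of Prop. 4.13 Case 1 (l. 2137–2141)] -/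
theorem rightRegular_eq_self_of_mem_kerArchAt₂
    [SMulInvariantMeasure (adelicGroupData F E c 2 J).Adelic (adelicGroupData F E c 2 J).automorphicQuotient μ]
    (P : DiscreteAutomorphicRep (adelicGroupData F E c 2 J) μ)
    {f : (adelicGroupData F E c 2 J).Adelic → ℂ} (hf : f ∈ holCotForms₂ F E c J hc hfix w₁ 𝔣)
    (h : MemLp (toQuotFun (adelicGroupData F E c 2 J) f) 2 μ) (hmem : h.toLp _ ∈ P.space) (hne : h.toLp _ ≠ 0)
    {k : (adelicGroupData F E c 2 J).Adelic} (hk : k ∈ ((archAt F E c 2 J w₁ (hfix w₁.1) hc).ker).map (archToAdelic F E c 2 J))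
    {v : (adelicGroupData F E c 2 J).L2 μ} (hv : v ∈ P.space) :
    (adelicGroupData F E c 2 J).rightRegular μ k v = v :=
  P.rightRegular_eq_self_of_form normal_kerArchAt₂ (left_inv_of_mem_holCotForms₂ hf) (right_inv_of_mem_holCotForms₂ hf) h hmem hne k hk v hv

/-- `R(k) (pr_P x) = pr_P x` for `k ∈ K_c(w₁)` and every `x ∈ L²([U(J)])` (the projection lands in `P`, Mathlib `Submodule.starProjection_apply_mem`).
[cite: BorelJacquet1979, §4.6] -/
theorem rightRegular_starProjection_of_mem_kerArchAt₂
    [SMulInvariantMeasure (adelicGroupData F E c 2 J).Adelic (adelicGroupData F E c 2 J).automorphicQuotient μ]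
    (P : DiscreteAutomorphicRep (adelicGroupData F E c 2 J) μ)
    {f : (adelicGroupData F E c 2 J).Adelic → ℂ} (hf : f ∈ holCotForms₂ F E c J hc hfix w₁ 𝔣)
    (h : MemLp (toQuotFun (adelicGroupData F E c 2 J) f) 2 μ) (hmem : h.toLp _ ∈ P.space) (hne : h.toLp _ ≠ 0)
    {k : (adelicGroupData F E c 2 J).Adelic} (hk : k ∈ ((archAt F E c 2 J w₁ (hfix w₁.1) hc).ker).map (archToAdelic F E c 2 J))
    (x : (adelicGroupData F E c 2 J).L2 μ) :
    (adelicGroupData F E c 2 J).rightRegular μ k (P.space.toSubmodule.starProjection x) = P.space.toSubmodule.starProjection x :=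
  rightRegular_eq_self_of_mem_kerArchAt₂ P hf h hmem hne hk (P.space.toSubmodule.starProjection_apply_mem x)

end Summit.HodgeConjecture.HodgeConjecture.Cruxes.HLiu418.F0LD2CurveHolTestVector

end
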